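import Summits.AnomalousDissipation.AnomalousDissipation.Theorems.FloorCertificate.Negative.WeakDuality
import Summits.AnomalousDissipation.AnomalousDissipation.Theorems.TaylorCertificatesFloorCertificateStubMinimaxAlternative
import Summits.AnomalousDissipation.AnomalousDissipation.Theorems.TaylorCertificatesFloorCertificateStubPenalisationLimit
import Summits.AnomalousDissipation.AnomalousDissipation.Theorems.TaylorCertificatesFloorCertificateStubFanMinimax
import Summits.AnomalousDissipation.AnomalousDissipation.Theorems.TaylorCertificatesFloorCertificateStubLscEnstrophy
import Summits.AnomalousDissipation.AnomalousDissipation.Theorems.TaylorCertificatesFloorCertificateStubSublevelCompact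
import Summits.AnomalousDissipation.AnomalousDissipation.Theorems.TaylorCertificatesFloorCertificateStubCylindricalCombination

/-!
# Stub `stub_targetIffDualPair` (T4) of the line `Sketch`
# (crux stmt-AnomalousDissipation-14086, `TaylorCertificates.FloorCertificateEnsembleCeiling` = the route target X)

THE CRUX IS EXACTLY ITS RELAXED DUAL. The crux X asks for ONE smooth solenoidal mean-zero force `f` and
`ε₀, E, ν₀ > 0` such that at every `ν ∈ (0, ν₀)` (a) a floor CERTIFICATE exists — a cylindrical `Φ₁`
and `θ₁ ≤ 0` with `ε₀ ≤ ν‖∇u‖² + ⟨F(u),Φ₁'(u)⟩ + 2θ₁((u,f) − ν‖∇u‖²)` at every finite-enstrophy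
state of the Leray ball `|u|² ≤ 16‖f‖²/ν²` — and (b) every stationary statistical solution of `NS_ν(f)`
(FMRT IV Def. 1.3) with integrable energy has mean energy `≤ E`. This file proves

  `X ↔ ∃ f admissible, ∃ ε₀ E ν₀ > 0, ∀ ν ∈ (0, ν₀): (i) every RELAXED stationary statistic of NS_ν(f)
   on the Leray ball dissipates ≥ ε₀ in the mean, and (ii) = (b) verbatim`,

where a relaxed stationary statistic is a Borel probability measure on `H` carried by the ball, of
finite mean enstrophy, annihilating every cylindrical Liouville functional, with integrable work and the
ONE global energy inequality `ε(μ) ≤ ∫(u,f)dμ` — the exact Lagrangian dual class of the certificates.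

Proof. `→` (weak duality, same constants): under a certificate the floor inequality holds `μ`-a.e.
(finite enstrophy a.e., ball a.e.); integrate; the Liouville identity kills the generator term and
`θ₁ ≤ 0` with the energy inequality signs the weight away (`relaxedLoud_local`, a file-local copy of
the landed `stub_relaxedLoudOfFloor` / `stub_weakDualityBudget`, whose modules have no olean on the hub
at the time of writing). `←` (strong duality, budget halved): if every relaxed statistic is `ε₀`-loud
at `(f, ν)`, a certificate with budget `ε₀/2` exists (`floorOfRelaxedFloor_local`, a file-local copy of
the landed `stub_floorOfRelaxedFloor`: the landed minimax alternative `stub_minimaxAlternative` of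
`TaylorCertificatesFloorCertificate` — fed the landed `stub_lscEnstrophy`, `stub_sublevelCompact`,
`stub_fanMinimax` (Ky Fan 1953, Thm 2), `stub_cylindricalCombination` — at `(L, γ, η) = (n, 3ε₀/4, ε₀/8)`
either certifies budget `5ε₀/8` or yields `(n, 7ε₀/8)`-approximately relaxed statistics whose
penalisation limit `stub_penalisationLimit` is relaxed with `ε ≤ 7ε₀/8 < ε₀`); the ceiling clause is
carried over verbatim.

References: Foias–Manley–Rosa–Temam (2001), Ch. IV §1.2 Def. 1.3, (1.29)–(1.34), Ch. V §1; Rosa–Temam,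
arXiv:2010.06730, Thms 6.2–6.4 (minimax characterisations of bounds on stationary statistical
solutions); Ky Fan, PNAS 39 (1953) 42–47, Thm 2.
-/

noncomputable section

set_option linter.dupNamespace false

namespace Summit.AnomalousDissipation.AnomalousDissipation.Theorems.TaylorCertificatesFloorCertificateEnsembleCeiling

open MeasureTheory Filter Topology
open Literature.Analysis.FunctionSpaces Literature.Analysis.FluidPDE
open scoped ENNReal
open Summit.AnomalousDissipation.AnomalousDissipation.Theorems.FloorCertificate.Negative

/-- Local notation: real vector fields on `T³`. -/
local notation "Vec3" => (UnitAddTorus (Fin 3)) → (EuclideanSpace ℝ (Fin 3))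
/-- Local notation: `L²(T³; ℝ³)`. -/
local notation "L2" => (Lp (EuclideanSpace ℝ (Fin 3)) 2 (volume : Measure (UnitAddTorus (Fin 3))))
/-- Local notation: the energy space `H`. -/
local notation "H3" => (Torus.energySpace (Fin 3))

/-- Weak duality for the floor at one viscosity (file-local copy of the landed `stub_relaxedLoudOfFloor`,
`Theorems/TaylorCertificatesFloorCertificateEnsembleCeilingStubRelaxedLoudOfFloor.lean`, p94252): a floor
certificate with budget `ε` at `(f, ν)` makes every relaxed stationary statistic `ε`-loud. -/
-- adapted from Theorems/TaylorCertificatesFloorCertificateEnsembleCeilingStubWeakDualityBudget.lean (constant budget)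
private theorem relaxedLoud_local {ν : ℝ} {f : Vec3} {Φ₁ : Torus.CylindricalTest (Fin 3)} {θ₁ ε : ℝ}
    {μ : Measure H3} (hθ₁ : θ₁ ≤ 0)
    (hfloor : ∀ u : H3, Torus.eGradNormSq ((u : L2) : Vec3) ≠ ⊤ → ‖u‖ ^ 2 ≤ 16 * (∫ x, ‖f x‖ ^ 2) / ν ^ 2 →
      ε ≤ ν * (Torus.eGradNormSq ((u : L2) : Vec3)).toReal + Torus.nsGeneratorPairing ν f u (Φ₁.grad u) +
        2 * θ₁ * (Torus.pairing (u : L2) f - ν * (Torus.eGradNormSq ((u : L2) : Vec3)).toReal))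
    (hprob : IsProbabilityMeasure μ) (hball : ∀ᵐ u ∂μ, ‖u‖ ^ 2 ≤ 16 * (∫ x, ‖f x‖ ^ 2) / ν ^ 2)
    (hZ : Torus.ensembleEnstrophy μ < ⊤)
    (hC : Integrable (fun u : H3 => Torus.nsGeneratorPairing ν f u (Φ₁.grad u)) μ)
    (hC0 : ∫ u, Torus.nsGeneratorPairing ν f u (Φ₁.grad u) ∂μ = 0)
    (hB : Integrable (fun u : H3 => Torus.pairing (u : L2) f) μ)
    (hE : Torus.ensembleDissipation ν μ ≤ ∫ u, Torus.pairing (u : L2) f ∂μ) :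
    ε ≤ Torus.ensembleDissipation ν μ := by
  set G : H3 → ℝ≥0∞ := fun u => Torus.eGradNormSq ((u : L2) : Vec3) with hG
  have hGm : Measurable G := Torus.measurable_eGradNormSq_coe
  have hGfin : ∫⁻ u, G u ∂μ < ∞ := hZ
  have hGlt : ∀ᵐ u ∂μ, G u < ∞ := ae_lt_top hGm hGfin.ne
  have hA : Integrable (fun u => (G u).toReal) μ :=
    integrable_toReal_of_lintegral_ne_top hGm.aemeasurable hGfin.ne
  -- the floor holds `μ`-a.e.
  have hae : ∀ᵐ u ∂μ, ε ≤ ν * (G u).toReal + Torus.nsGeneratorPairing ν f u (Φ₁.grad u) +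
      2 * θ₁ * (Torus.pairing (u : L2) f - ν * (G u).toReal) := by
    filter_upwards [hGlt, hball] with u hu hb
    exact hfloor u hu.ne hb
  -- integrate
  have h1 : Integrable (fun u : H3 => ν * (G u).toReal) μ := hA.const_mul ν
  have h2 : Integrable (fun u : H3 => ν * (G u).toReal + Torus.nsGeneratorPairing ν f u (Φ₁.grad u)) μ :=
    h1.add hC
  have h3 : Integrable (fun u : H3 => Torus.pairing (u : L2) f - ν * (G u).toReal) μ := hB.sub h1
  have h4 : Integrable (fun u : H3 => 2 * θ₁ * (Torus.pairing (u : L2) f - ν * (G u).toReal)) μ :=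
    h3.const_mul _
  have hint : Integrable (fun u : H3 => ν * (G u).toReal + Torus.nsGeneratorPairing ν f u (Φ₁.grad u) +
      2 * θ₁ * (Torus.pairing (u : L2) f - ν * (G u).toReal)) μ := h2.add h4
  have hmono := integral_mono_ae (integrable_const ε) hint hae
  have hconst : ∫ _ : H3, ε ∂μ = ε := by simp
  have hsplit : ∫ u : H3, (ν * (G u).toReal + Torus.nsGeneratorPairing ν f u (Φ₁.grad u) +
      2 * θ₁ * (Torus.pairing (u : L2) f - ν * (G u).toReal)) ∂μ =
      ν * (∫⁻ u, G u ∂μ).toReal + 0 +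
        2 * θ₁ * (∫ u : H3, Torus.pairing (u : L2) f ∂μ - ν * (∫⁻ u, G u ∂μ).toReal) := by
    rw [integral_add h2 h4, integral_add h1 hC, integral_const_mul, integral_const_mul, integral_sub hB h1,
      integral_const_mul, hC0, integral_toReal hGm.aemeasurable hGlt]
  rw [hconst, hsplit] at hmono
  have hE' : ν * (∫⁻ u, G u ∂μ).toReal ≤ ∫ u, Torus.pairing (u : L2) f ∂μ := hE
  have hθ : 2 * θ₁ * (∫ u, Torus.pairing (u : L2) f ∂μ - ν * (∫⁻ u, G u ∂μ).toReal) ≤ 0 :=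
    mul_nonpos_of_nonpos_of_nonneg (by linarith) (by linarith)
  change ε ≤ ν * (∫⁻ u, G u ∂μ).toReal
  linarith

/-- Strong duality for the floor at one viscosity (file-local copy of the landed `stub_floorOfRelaxedFloor`,
`Theorems/TaylorCertificatesFloorCertificateEnsembleCeilingStubFloorOfRelaxedFloor.lean`, p91809): uniform
`ε₀`-loudness of the relaxed stationary statistics of `(f, ν)` gives a certificate with budget `ε₀/2`. -/
-- adapted from Theorems/TaylorCertificatesFloorCertificateEnsembleCeilingStubFloorOfRelaxedFloor.lean (verbatim)
private theorem floorOfRelaxedFloor_local {ν : ℝ} {f : Vec3} {ε₀ : ℝ} (hν : 0 < ν) (hfs : Torus.IsSmooth f)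
    (hε₀ : 0 < ε₀)
    (hloud : ∀ μ : Measure H3,
      IsProbabilityMeasure μ →
      (∀ᵐ u ∂μ, ‖u‖ ^ 2 ≤ 16 * (∫ x, ‖f x‖ ^ 2) / ν ^ 2) →
      Torus.ensembleEnstrophy μ < ⊤ →
      (∀ Φ : Torus.CylindricalTest (Fin 3),
        Integrable (fun u => Torus.nsGeneratorPairing ν f u (Φ.grad u)) μ ∧
          ∫ u, Torus.nsGeneratorPairing ν f u (Φ.grad u) ∂μ = 0) →
      Integrable (fun u : H3 => Torus.pairing (u : L2) f) μ →
      Torus.ensembleDissipation ν μ ≤ ∫ u, Torus.pairing (u : L2) f ∂μ →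
      ε₀ ≤ Torus.ensembleDissipation ν μ) :
    ∃ (Φ₁ : Torus.CylindricalTest (Fin 3)) (θ₁ : ℝ), θ₁ ≤ 0 ∧
      ∀ u : H3, Torus.eGradNormSq ((u : L2) : Vec3) ≠ ⊤ → ‖u‖ ^ 2 ≤ 16 * (∫ x, ‖f x‖ ^ 2) / ν ^ 2 →
        ε₀ / 2 ≤ ν * (Torus.eGradNormSq ((u : L2) : Vec3)).toReal + Torus.nsGeneratorPairing ν f u (Φ₁.grad u) +
          2 * θ₁ * (Torus.pairing (u : L2) f - ν * (Torus.eGradNormSq ((u : L2) : Vec3)).toReal) := by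
  by_contra hno
  -- for every slope `n`, the alternative at `(L, γ, η) = (n, 3ε₀/4, ε₀/8)` takes its second horn
  have hB := fun n : ℕ =>
    (TaylorCertificatesFloorCertificate.stub_minimaxAlternative
      TaylorCertificatesFloorCertificate.stub_lscEnstrophy
      (TaylorCertificatesFloorCertificate.stub_sublevelCompact
        TaylorCertificatesFloorCertificate.stub_lscEnstrophy)
      TaylorCertificatesFloorCertificate.stub_fanMinimax
      TaylorCertificatesFloorCertificate.stub_cylindricalCombination ν f hν hfs n (3 * ε₀ / 4) (ε₀ / 8)
      (Nat.cast_nonneg n) (by positivity)).resolve_left fun ⟨Φ, θ, _, hθ0, _, hfloor⟩ =>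
        hno ⟨Φ, θ, hθ0, fun u h1 h2 => le_trans (by linarith) (hfloor u h1 h2)⟩
  choose μs hμs using hB
  -- the penalisation limit of the approximately relaxed statistics is relaxed and too quiet
  obtain ⟨μ, ⟨hprob, hball, hZ, hLiou, hW, hE⟩, hdiss⟩ :=
    TaylorCertificatesFloorCertificate.stub_penalisationLimit
      TaylorCertificatesFloorCertificate.stub_lscEnstrophy
      (TaylorCertificatesFloorCertificate.stub_sublevelCompact
        TaylorCertificatesFloorCertificate.stub_lscEnstrophy)
      TaylorCertificatesFloorCertificate.stub_cylindricalCombination ν f hν hfs _ μs hμs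
  have h := hloud μ hprob hball hZ hLiou hW hE
  linarith

/-- **The crux X is EXACTLY its relaxed dual.** `FloorCertificateEnsembleCeiling` (one force with a floor
CERTIFICATE and an ensemble CEILING at every small viscosity) holds iff some smooth solenoidal mean-zero
force `f` and `ε₀, E, ν₀ > 0` have, at every `ν ∈ (0, ν₀)`, (i) every RELAXED stationary statistic of
`NS_ν(f)` on the Leray ball — a Borel probability measure on `H` carried by `{|u|² ≤ 16‖f‖²/ν²}`, of
finite mean enstrophy, annihilating every cylindrical Liouville functional, with integrable work and the
one global energy inequality — dissipating at least `ε₀` in the mean, and (ii) every stationary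
statistical solution (FMRT IV Def. 1.3) with integrable energy having mean energy `≤ E`. `→`: weak
duality (same constants); `←`: strong duality (Ky Fan minimax + penalisation limit, landed in
`TaylorCertificatesFloorCertificate*`), floor budget `ε₀/2`; clause (ii) is X's ceiling clause verbatim. -/
theorem stub_targetIffDualPair :
    Summit.AnomalousDissipation.AnomalousDissipation.Theses.TaylorCertificates.FloorCertificateEnsembleCeiling ↔
      ∃ f : Vec3, Torus.IsSmooth f ∧ Torus.IsDivFree f ∧ Torus.HasZeroMean f ∧
        ∃ ε₀ E ν₀ : ℝ, 0 < ε₀ ∧ 0 < ν₀ ∧ ∀ ν : ℝ, 0 < ν → ν < ν₀ →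
          (∀ μ : Measure H3,
            IsProbabilityMeasure μ →
            (∀ᵐ u ∂μ, ‖u‖ ^ 2 ≤ 16 * (∫ x, ‖f x‖ ^ 2) / ν ^ 2) →
            Torus.ensembleEnstrophy μ < ⊤ →
            (∀ Φ : Torus.CylindricalTest (Fin 3),
              Integrable (fun u => Torus.nsGeneratorPairing ν f u (Φ.grad u)) μ ∧
                ∫ u, Torus.nsGeneratorPairing ν f u (Φ.grad u) ∂μ = 0) →
            Integrable (fun u : H3 => Torus.pairing (u : L2) f) μ →
            Torus.ensembleDissipation ν μ ≤ ∫ u, Torus.pairing (u : L2) f ∂μ →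
            ε₀ ≤ Torus.ensembleDissipation ν μ) ∧
          (∀ μ : Measure H3, Torus.IsStationaryStatisticalSolution ν f μ →
            Integrable (fun v : H3 => ‖v‖ ^ 2) μ → Torus.ensembleEnergy μ ≤ E) := by
  constructor
  · rintro ⟨f, hfs, hfd, hfz, ε₀, E, ν₀, hε₀, hν₀, hX⟩
    refine ⟨f, hfs, hfd, hfz, ε₀, E, ν₀, hε₀, hν₀, fun ν hν hνlt => ⟨?_, (hX ν hν hνlt).2⟩⟩
    obtain ⟨⟨Φ₁, θ₁, hθ₁, hfloor⟩, -⟩ := hX ν hν hνlt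
    intro μ hprob hball hZ hLiou hB hE
    exact relaxedLoud_local hθ₁ (fun u => hfloor u) hprob hball hZ (hLiou Φ₁).1 (hLiou Φ₁).2 hB hE
  · rintro ⟨f, hfs, hfd, hfz, ε₀, E, ν₀, hε₀, hν₀, h⟩
    refine ⟨f, hfs, hfd, hfz, ε₀ / 2, E, ν₀, half_pos hε₀, hν₀, fun ν hν hνlt => ?_⟩
    obtain ⟨hfloor, hceil⟩ := h ν hν hνlt
    obtain ⟨Φ₁, θ₁, hθ₁, hfl⟩ := floorOfRelaxedFloor_local hν hfs hε₀ hfloor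
    exact ⟨⟨Φ₁, θ₁, hθ₁, fun u => hfl u⟩, hceil⟩

end Summit.AnomalousDissipation.AnomalousDissipation.Theorems.TaylorCertificatesFloorCertificateEnsembleCeiling

end
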